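import Summits.QuantumFields.YangMills.Theorems.UnitScaleTiltHalvingSmallMembersCoverLift
import Summits.QuantumFields.YangMills.Theorems.UnitScaleTiltWilsonActionFirstVariation
import Summits.QuantumFields.YangMills.Theorems.UnitScaleTiltProp7FirstVariationMultiplier
import HarnessLib

/-!
# Route `UnitScaleTilt`, crux K1 child «MinimiserStabilityRegPr» (stmt-QuantumFields-19200), stub `stub_halvingStep` (H), residual «H-SMALL», route (b7) «COVER LIFT»
# (★★OWNER RULINGS №28∕№30 (4)) — **LIFT PACKAGE, FILE 2b: THE STATIONARITY LIFT `statLift_of_tangentLift`** — R2-criticality of `U` at the member ⇒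
# stationarity of the Wilson action along every bondwise-differentiable exact-fibre curve through the lift `U ∘ π` at the cover member (the `hlift`
# input of FILE 2a ✓`SmallMembersCoverLiftStub.stub_of_roomHalvingStat`), MODULO ONE DISPLAYED ROW `htan` — «the push-forward `π_*ξ̃` of the velocity field
# of such a curve is the velocity of SOME member curve through `U` with ZERO first-order constraint velocity» (the linearised-fibre content of ★★OWNER №28 (2)
# «if the lift needs the fibre to be a manifold at Ũ, say so and display it»; discharged in FILE 3 by the Fréchet∕deck-equivariance argument)

Cell `ym3-torus` (HUMAN RULING D-0037: YM₃ on T³ is ladder rung R3, not the Clay problem), width seat `ym-ust-20520-w3` gen 5.  `--supports stmt-QuantumFields-19200 --as helper`;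
def-free, 0 sorry, standard axioms.  CONDITIONAL on `htan`; nothing here closes the stub.

THE CHAIN (all by name): velocities right-trivialised `ξ̃ b̃ := γ̃′(0)(b̃)·Ũ(b̃)^*` (✓`WilsonActionFirstVariation.hasDerivAt_mul_star_of_differentiableAt`, ★w7-20520 g0); FIRST
VARIATIONS PUSH FORWARD EXACTLY: `HasDerivAt (A ∘ γ̃) (Lin_U(π_* ξ̃)) 0` (✓`hasDerivAt_wilsonAction4_cover`: locality of the current `D^{1*}_U ∂U` + FILE 1
✓`SmallMembersCoverLift.covDivT_comp_proj` + ✓`CoverSites.sum_pullback_mul_eq_sum_mul_pushBond`); THE MULTIPLIER BOUND at the R2-critical member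
✓`Prop7FirstVariationMultiplier.abs_lin_le_constraint_velocity` (★w1-19200: `|Lin_U(A)| ≤ 2ε₀L^{−(K−n)}·Σ_c‖constraint velocity‖` along ANY member curve with velocity `A`);
`htan` supplies such a curve with zero constraint velocity for `A := π_* ξ̃`; hence `Lin_U(π_* ξ̃) = 0` and `deriv (A ∘ γ̃) 0 = 0`.

WHAT IS PROVED: ★★`statLift_of_tangentLift (htan) : <FILE 2a's hlift binder, verbatim>` with `aS(L) := (10¹⁰·L⁶)⁻¹`.

References: T. Bałaban, CMP **102** (1985) 277–309 [Balaban1985Variational] ((2), (6) p.278, (26)–(27) p.282, (127) p.297, (141)–(144) pp.299–300).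
-/

set_option autoImplicit false

noncomputable section

open scoped BigOperators Matrix.Norms.L2Operator Matrix

namespace Summit.QuantumFields.YangMills.Theorems.SmallMembersCoverLiftStat

open Literature.MathematicalPhysics.QuantumFieldTheory.Balaban1983to89
open BlockAveraging ExpMeanLog
open T3ContinuumYM3Torus (T3Family)
open T3Thm1CarrierNative (IsCritR2)
open T3PrintedRegularMinimiser (RegPr)
open T3ConstrainedMinimiser (fibre)
open T3UnitLawDensityEML (ℰp)
open CoverSites (cover proj projBond pushBond)
open Summit.QuantumFields.YangMills.Theorems.WilsonActionFirstVariation (hasDerivAt_mul_star_of_differentiableAt hasDerivAt_wilsonAction4_cover)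
open Summit.QuantumFields.YangMills.Theorems.Prop7FirstVariationMultiplier (abs_lin_le_constraint_velocity)

/-- ★★ **THE STATIONARITY LIFT, MODULO THE TANGENT ROW.**  `htan` (DISPLAYED): for every member datum and every bondwise-differentiable exact-fibre curve `γ̃` through
the lift `U ∘ π` at the cover member, the push-forward `π_* ξ̃` of its right-trivialised velocity field is the right-trivialised velocity of a member curve `Γ₀`
through `U` whose `(K − n)`-fold (0.4)-average has ZERO bondwise derivative at `0`.  Conclusion = FILE 2a's `hlift` binder verbatim, with `aS(L) := (10¹⁰L⁶)⁻¹`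
(the window of ✓`abs_lin_le_constraint_velocity`).  [cite: Balaban1985Variational, (127) p.297, (141)-(144) pp.299-300] -/
theorem statLift_of_tangentLift
    (htan : ∀ (F : T3Family) (jc n K : ℕ) (hnK : n < K) (ε₀ : ℝ)
      (V : GaugeField (F.P n) 0 (Matrix.specialUnitaryGroup (Fin 2) ℂ)) (U : GaugeField (F.P K) 0 (Matrix.specialUnitaryGroup (Fin 2) ℂ)),
      0 < ε₀ → 10 ^ 10 * (F.L : ℝ) ^ 6 * ε₀ ≤ 1 → RegPr F n K ε₀ U → IsCritR2 F n K hnK.le V U →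
      ∀ γ : ℝ → GaugeField ((F.cover jc).P K) 0 (Matrix.specialUnitaryGroup (Fin 2) ℂ), γ 0 = U ∘ projBond (F.P K) jc 0 →
        (∀ t, γ t ∈ fibre (F.cover jc) ℰp n K hnK.le (V ∘ projBond (F.P n) jc 0)) →
        (∀ b, DifferentiableAt ℝ (fun t => ((γ t b : Matrix.specialUnitaryGroup (Fin 2) ℂ) : Matrix (Fin 2) (Fin 2) ℂ)) 0) →
        ∃ Γ₀ : ℝ → GaugeField (F.P K) 0 (Matrix.specialUnitaryGroup (Fin 2) ℂ), Γ₀ 0 = U ∧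
          (∀ b : PBond (F.P K) 0, HasDerivAt (fun s : ℝ => ((Γ₀ s b : Matrix.specialUnitaryGroup (Fin 2) ℂ) : Matrix (Fin 2) (Fin 2) ℂ))
            (pushBond (F.P K) jc 0 (fun bt : PBond ((F.cover jc).P K) 0 =>
                deriv (fun t : ℝ => ((γ t bt : Matrix.specialUnitaryGroup (Fin 2) ℂ) : Matrix (Fin 2) (Fin 2) ℂ)) 0 *
                  star ((U (projBond (F.P K) jc 0 bt) : Matrix.specialUnitaryGroup (Fin 2) ℂ) : Matrix (Fin 2) (Fin 2) ℂ)) b *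
              ((U b : Matrix.specialUnitaryGroup (Fin 2) ℂ) : Matrix (Fin 2) (Fin 2) ℂ)) 0) ∧
          ∀ c : PBond (F.P K) (K - n),
            deriv (fun s : ℝ => ((Averaging.iter (fun i => blockAvg (P := F.P K) (j := i) (expMeanLogSU (n := Fin 2))) (K - n) (Γ₀ s) c :
              Matrix.specialUnitaryGroup (Fin 2) ℂ) : Matrix (Fin 2) (Fin 2) ℂ)) 0 = 0) :
    ∀ L : ℕ, 1 < L → ∃ aS : ℝ, 0 < aS ∧ ∀ (F : T3Family), F.L = L → ∀ (jc n K : ℕ) (hnK : n < K) (ε₀ : ℝ)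
      (V : GaugeField (F.P n) 0 (Matrix.specialUnitaryGroup (Fin 2) ℂ)) (U : GaugeField (F.P K) 0 (Matrix.specialUnitaryGroup (Fin 2) ℂ)),
      0 < ε₀ → ε₀ ≤ aS → RegPr F n K ε₀ U → IsCritR2 F n K hnK.le V U →
      ∀ γ : ℝ → GaugeField ((F.cover jc).P K) 0 (Matrix.specialUnitaryGroup (Fin 2) ℂ), γ 0 = U ∘ projBond (F.P K) jc 0 →
        (∀ t, γ t ∈ fibre (F.cover jc) ℰp n K hnK.le (V ∘ projBond (F.P n) jc 0)) →
        (∀ b, DifferentiableAt ℝ (fun t => ((γ t b : Matrix.specialUnitaryGroup (Fin 2) ℂ) : Matrix (Fin 2) (Fin 2) ℂ)) 0) →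
        deriv (fun t => wilsonAction4 (γ t)) 0 = 0 := by
  classical
  intro L hL
  have hL0 : (0 : ℝ) < L := by exact_mod_cast (show 0 < L by omega)
  refine ⟨(10 ^ 10 * (L : ℝ) ^ 6)⁻¹, by positivity, ?_⟩
  intro F hF jc n K hnK ε₀ V U hε₀ hε₀a hreg hcrit γ hγ0 hγfib hγdiff
  -- the smallness window of the multiplier bound
  have hε : 10 ^ 10 * (F.L : ℝ) ^ 6 * ε₀ ≤ 1 := by
    rw [hF]
    have h10 : (0 : ℝ) < 10 ^ 10 * (L : ℝ) ^ 6 := by positivity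
    calc 10 ^ 10 * (L : ℝ) ^ 6 * ε₀ ≤ 10 ^ 10 * (L : ℝ) ^ 6 * (10 ^ 10 * (L : ℝ) ^ 6)⁻¹ := mul_le_mul_of_nonneg_left hε₀a h10.le
      _ = 1 := mul_inv_cancel₀ h10.ne'
  -- the right-trivialised velocity field of `γ` and the first variation pushed forward to the member
  set ξt : PBond ((F.cover jc).P K) 0 → Matrix (Fin 2) (Fin 2) ℂ := fun bt =>
    deriv (fun t : ℝ => ((γ t bt : Matrix.specialUnitaryGroup (Fin 2) ℂ) : Matrix (Fin 2) (Fin 2) ℂ)) 0 *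
      star ((U (projBond (F.P K) jc 0 bt) : Matrix.specialUnitaryGroup (Fin 2) ℂ) : Matrix (Fin 2) (Fin 2) ℂ) with hξt
  have hγξ : ∀ bt : PBond ((F.cover jc).P K) 0,
      HasDerivAt (fun t : ℝ => ((γ t bt : Matrix.specialUnitaryGroup (Fin 2) ℂ) : Matrix (Fin 2) (Fin 2) ℂ) *
        star (((U ∘ projBond (F.P K) jc 0) bt : Matrix.specialUnitaryGroup (Fin 2) ℂ) : Matrix (Fin 2) (Fin 2) ℂ)) (ξt bt) 0 :=
    fun bt => hasDerivAt_mul_star_of_differentiableAt γ (U ∘ projBond (F.P K) jc 0) bt (hγdiff bt)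
  have hD := hasDerivAt_wilsonAction4_cover (P := F.P K) (jc := jc) (j := 0) (U₀ := U) γ hγ0 ξt hγξ
  -- the tangent row: a member curve with velocity `π_* ξ̃` and zero constraint velocity
  obtain ⟨Γ₀, hΓ₀0, hΓ₀d, hvel⟩ := htan F jc n K hnK ε₀ V U hε₀ hε hreg hcrit γ hγ0 hγfib hγdiff
  -- the multiplier bound kills the pushed first variation
  have hbound := abs_lin_le_constraint_velocity F hnK.le hcrit hε₀ hε hreg Γ₀ hΓ₀0 (pushBond (F.P K) jc 0 ξt) hΓ₀d
  have hrhs : (2 * ε₀ * ((F.L : ℝ) ^ (K - n))⁻¹ * ∑ c : PBond (F.P K) (K - n),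
      ‖deriv (fun s : ℝ => ((Averaging.iter (fun i => blockAvg (P := F.P K) (j := i) (expMeanLogSU (n := Fin 2))) (K - n) (Γ₀ s) c :
        Matrix.specialUnitaryGroup (Fin 2) ℂ) : Matrix (Fin 2) (Fin 2) ℂ)) 0‖) = 0 := by
    rw [Finset.sum_eq_zero fun c _ => by rw [hvel c, norm_zero], mul_zero]
  rw [hrhs] at hbound
  have hLin0 := abs_nonpos_iff.mp hbound
  rw [hLin0] at hD
  exact hD.deriv

end Summit.QuantumFields.YangMills.Theorems.SmallMembersCoverLiftStat

end
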